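import Summits.QuantumFields.YangMills.Theorems.UnitScaleTiltProp7RowPOfFaceFluxRowsOfHE
import Summits.QuantumFields.YangMills.Theorems.UnitScaleTiltProp7CovFaceFluxLineStepPrime
import HarnessLib

/-!
# Route `UnitScaleTilt`, crux K1 «MinimiserStabilityRegPr» (stmt-QuantumFields-19200), route-R E′ S3 — ROW (P) KNIT v1.1 («cure (b)»): THE MEMBER AT THE COMB-DIRECT FACE FUNCTIONAL
# `FACE′`, ITS (E)-ROW DISCHARGED BY px15's ✓`Prop7CovFaceFluxLineStepPrime.sum_normSq_lineFun_sub_combFaceFun_le`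

Cell `ym3-torus`, width seat `ym3-torus-px5` (gen 3), 2026-08-29 (px15 g3 01:02:58Z «FACE′ re-instantiation = cure (b), yours; hE′ is ready»; LOCATE-HXB-SPLIT-px15g3.md §0.2).  THEOREMS ONLY
(0 `def`, 0 `sorry`); `--supports stmt-QuantumFields-19200 --as helper`, count-neutral.  YM₃ on T³ is a ladder rung (R3), not the Clay problem; nothing here claims the stub, the crux, d = 4 or
the mass gap; the rows `hXb′`, `hq` are DISPLAYED, not proved.
WHY.  px15's split `hXb′ ⟸ hDirGauss ∧ hVH` of the Gauss composite (BLOCK-GAUSS ✓p680339∕✓p680975, INT-PAIRING ✓p681851, INT-CS ✓p682982, INT-TRANSPORT ✓p684144) is EXACT against the COMB-DIRECT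
face functional `FACE′_c = Vk⁻¹·gL_c·(ℓ·Σ_r R(holT 𝒰 ȳ (treeWord (update r μ_c (ℓ−1)))) B(shift_{μ_c}^{ℓ−1−r_{μ_c}} x_r))·gL_c*` (✓p670095's second functional; centre frame `gL_c = holAt W (centre → corner)`).
This file instantiates ✓`Prop7RowPOfFaceFluxRowsOfHE.rowP_of_faceFluxRows_of_hE` at `FACE := FACE′` and DISCHARGES its (E)-row by px15's ✓p684329 at `δ := 2e·ℓ⁻²` (`PlaqSmall` from the clause
`dist1 ≤ e·ℓ⁻²`), `t₀(c, r) = ℓ − 1 − r_{μ_c}`, `s′ = ℓ − 1`: at `d = 3`, `Elong′ ≤ 2ℓ·G_long + 9604e²·(ℓ⁻¹·M_B + ℓ·G_long) ≤ 3ℓ·G_W(B) + 2e·ℓ⁻¹·M` (`(7ℓ)²∕2 · 2eℓ⁻² = 49e`, `2·49²·2 = 9604`,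
`9604e ≤ 1`, `G_long ≤ G_W` ✓`sum_longGrad_le_covGrad`, `M_B ≤ 2M` ✓`sum_norm_sq_le_of_coclosed_split`; §1 `face_prime_booking`), i.e. `C_E = 3`, `θ_E = 2`:
★★★ `rowP_of_combFaceFluxRows` — ROW (P′) at `(ζ_X∕θ, θ + θ_q, θ_X + 64(C_G+C_S²) + 768·10⁹L⁹ + 16, C_X + 24, 19200L⁴, η_X + η_q)` from the displayed rows `hXb′` (the Gauss composite AGAINST
`FACE′` — exactly the row px15's «HXB′ DOOR» concludes) and `hq` (fibre defect, routeR-w2).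
HONEST SCOPE.  Composition of landed theorems; `hXb′`, `hq` are INPUTS; constants crude, `L`-only; no estimate of Bałaban's is asserted.
References: T. Bałaban, CMP 102 (1985) 277–309 [Balaban1985Variational] ((6) p.278, (141)–(143) p.299, Prop. 7 p.299); CMP 99 (1985) 389–434 [Balaban1985BackgroundPropagators] ((3.3) p.390,
(3.8)–(3.10) p.392, Thm 3.11 p.416); CMP 98 (1985) 17–51 [Balaban1985Averaging] ((11) p.19, (19) p.21, Prop. 3 (124)–(126) p.36).
-/

set_option autoImplicit false

noncomputable section

open scoped BigOperators Matrix.Norms.L2Operator Matrix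

namespace Summit.QuantumFields.YangMills.Theorems.Prop7RowPOfCombFaceFluxRows
open Literature.MathematicalPhysics.QuantumFieldTheory.Balaban1983to89
open Literature.MathematicalPhysics.QuantumFieldTheory.Balaban1983to89.T3ContinuumYM3Torus
open Finset T4Continuum T4ReflectionCone BlockAveraging AveragingRT ExpMeanLog BlockAveragingEMLLinearised BlockAveragingEMLLinearisedBackground
  BlockAveragingEMLProp2 B1RG242Torus
open B15DeterminingSets (embIter)
open B7Prop1Explicit (U1 treeWord)
open B7Eq78Linearization (conjR)
open B9Eq39Adjoint (covD divB curl)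
open B9TorusCalculus (torusT)
open B10Eq27TorusAxialLog (holT unitsField toUField holT_nil holT_cons_true holT_cons_false)
open Summit.QuantumFields.YangMills.Theorems.Prop7CovIterLambdaBound (plaqSmall_of_le_of_lt)
open Summit.QuantumFields.YangMills.Theorems.Prop7CurvedLandauKnitT3 (smallness_T3 three_le_L)
open Summit.QuantumFields.YangMills.Theorems.Prop7CurvedLandauRowA (exists_reduced_family exists_coarseGauge_family)
open Summit.QuantumFields.YangMills.Theorems.Prop7LineIterVsEngineOfTower (exists_pureLine_family)
open Summit.QuantumFields.YangMills.Theorems.Prop7CovConstraintSplitOfRegPr (covConstraintSplit_coclosed_T3)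
open Summit.QuantumFields.YangMills.Theorems.Prop7DefBookingEM (sum_normSq_reduced_sub_engine_le_of_tower)
open Summit.QuantumFields.YangMills.Theorems.Prop7CovFaceFluxRow (sum_normSq_centreDiff_le_of_rows)
open Summit.QuantumFields.YangMills.Theorems.Prop7CoclosedEnergiesOfHKgK (sum_norm_sq_le_of_coclosed_split)
open Summit.QuantumFields.YangMills.Theorems.Prop7CovCombMeanFrames (conjR_bond_su)
open Summit.QuantumFields.YangMills.Theorems.Prop7RowPOfFaceFluxRows (real_smul_eq_coe_smul sum_longGrad_le_covGrad)
open Summit.QuantumFields.YangMills.Theorems.Prop7CovFaceFluxLineStepPrime (sum_normSq_lineFun_sub_combFaceFun_le)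

open Summit.QuantumFields.YangMills.Theorems.Prop7RowPOfFaceFluxRowsOfHE (rowP_of_faceFluxRows_of_hE)

/-! ## §1 The arithmetic of the comb-direct (E)-row at `d = 3` -/

/-- Bookkeeping of px15's (E)-row with the comb-direct face functional at `d = 3`, `δ = 2e·ℓ⁻²`: `2ℓ⁴ℓ⁻³·G_long + 2·((7ℓ)²∕2·2eℓ⁻²)²·2ℓ²ℓ⁻³·(M_B + ℓ²G_long) ≤ 3ℓ·G_W + 2e·ℓ⁻¹·M`
given `9604e ≤ 1`, `G_long ≤ G_W`, `M_B ≤ 2M`. [cite: Balaban1985BackgroundPropagators, (3.3) p.390] -/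
theorem face_prime_booking {ℓ e GLo MB GW MD : ℝ} (hℓ : 0 < ℓ) (he : 0 ≤ e) (he4 : 9604 * e ≤ 1) (hGLo : 0 ≤ GLo) (hMB : 0 ≤ MB)
    (hGLW : GLo ≤ GW) (hBM : MB ≤ 2 * MD) :
    2 * (ℓ ^ 4 * (ℓ ^ 3)⁻¹ * GLo) + 2 * (((7 * ℓ) ^ 2 / 2 * (2 * e * ℓ⁻¹ ^ 2)) ^ 2 * 2 * ℓ ^ 2 * (ℓ ^ 3)⁻¹ * (MB + ℓ ^ 2 * GLo))
      ≤ 3 * ℓ * GW + 2 * e * ℓ⁻¹ * MD := by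
  have hℓ0 : ℓ ≠ 0 := hℓ.ne'
  have h1 : ℓ ^ 4 * (ℓ ^ 3)⁻¹ = ℓ := by field_simp
  have h2 : 2 * (((7 * ℓ) ^ 2 / 2 * (2 * e * ℓ⁻¹ ^ 2)) ^ 2 * 2 * ℓ ^ 2 * (ℓ ^ 3)⁻¹ * (MB + ℓ ^ 2 * GLo))
      = 9604 * e ^ 2 * ℓ⁻¹ * MB + 9604 * e ^ 2 * ℓ * GLo := by
    field_simp
    ring
  rw [h1, h2]
  have hX : 9604 * e ^ 2 ≤ e := by nlinarith
  have hX1 : 9604 * e ^ 2 ≤ 1 := hX.trans (by nlinarith)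
  have hA1 : 9604 * e ^ 2 * ℓ⁻¹ * MB ≤ e * ℓ⁻¹ * (2 * MD) :=
    mul_le_mul (mul_le_mul_of_nonneg_right hX (inv_nonneg.mpr hℓ.le)) hBM hMB (mul_nonneg he (inv_nonneg.mpr hℓ.le))
  have hA2 : 9604 * e ^ 2 * ℓ * GLo ≤ 1 * ℓ * GW :=
    mul_le_mul (mul_le_mul_of_nonneg_right hX1 hℓ.le) hGLW hGLo (mul_nonneg zero_le_one hℓ.le)
  have hA3 : ℓ * GLo ≤ ℓ * GW := mul_le_mul_of_nonneg_left hGLW hℓ.le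
  linarith

/-! ## §2 ★★★ ROW (P) of the R5 door at the comb-direct face functional — the (E)-row discharged -/

set_option maxHeartbeats 400000 in
/-- ★★★ **ROW (P) KNIT v1.1 (cure (b)) — THE COMB-DIRECT FACE FUNCTIONAL.**  As ✓`Prop7RowPOfFaceFluxRows.rowP_of_faceFluxRows`, but the Gauss composite is displayed AGAINST
`FACE′_c = Vk⁻¹·gL_c·(ℓ·Σ_r R(holT 𝒰 ȳ (treeWord (update r μ_c (ℓ−1)))) B(face r))·gL_c*` (✓`Prop7CovFaceFluxFacePiece`'s comb-direct functional; `face r = shift_{μ_c}^{ℓ−1−r_{μ_c}} x_r`,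
centre frame `gL_c = holAt W (centre → corner)`): DISPLAYED ROWS `hq` and `hXb′ : 2|Σ_c Re tr((φ₀(c₋) − W̄(c)φ₀(c₊)W̄(c)*)ᴴ·FACE′_c)| ≤ ℓ(ζ_X∕θ)K + θℓ⁻¹M + θ_X·e·ℓ⁻¹M + C_X·ℓ·G_W(B) + η_X·ℓ·DIV(D)`;
the (E)-row is DISCHARGED (px15 ✓`sum_normSq_lineFun_sub_combFaceFun_le` at `δ = 2e·ℓ⁻²`, booked by §1: `C_E = 3`, `θ_E = 2`).  CONCLUSION = ROW (P′) at
`(ζ_X∕θ, θ + θ_q, θ_X + 64(C_G+C_S²) + 768·10⁹L⁹ + 16, C_X + 24, 19200L⁴, η_X + η_q)`.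
[cite: Balaban1985Variational, (6) p.278, (141)-(143) p.299, Prop. 7 p.299; Balaban1985BackgroundPropagators, (3.3) p.390, (3.8)-(3.10) p.392, Thm 3.11 p.416; Balaban1985Averaging, (11) p.19, (19) p.21, Prop. 3 (124)-(126) p.36] -/
theorem rowP_of_combFaceFluxRows (F : T3Family) (n K : ℕ) (W : GaugeField (F.P K) 0 (Matrix.specialUnitaryGroup (Fin 2) ℂ))
    {e θ ζ_X θ_X C_X η_X θ_q η_q : ℝ} (he : 0 < e) (heL : 1000000 * (F.L : ℝ) ^ 5 * e ≤ 1)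
    (hW : ∀ p : Plaq (F.P K) 0, dist1 (GaugeField.plaqHol W p) ≤ e * (((F.L : ℝ) ^ (K - n)) ^ 2)⁻¹)
    (D B : PBond (F.P K) 0 → Matrix (Fin 2) (Fin 2) ℂ) (φ₀ : Site (F.P K) 0 → Matrix (Fin 2) (Fin 2) ℂ)
    (hsplit : ∀ b : PBond (F.P K) 0, D b = B b + covD (torusT (F.P K) 0) (fun κ z => unitsField (toUField W) ⟨z, κ⟩) b.dir φ₀ b.src)
    (hBc : ∀ x : Site (F.P K) 0, divB (torusT (F.P K) 0) (fun κ z => unitsField (toUField W) ⟨z, κ⟩) (fun κ z => B ⟨z, κ⟩) x = 0)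
    -- the true linearised iterate of record, displayed by its recursion (✓`exists_trueLinIter_family`)
    (Q : (k : ℕ) → (PBond (F.P K) 0 → Matrix (Fin 2) (Fin 2) ℂ) → PBond (F.P K) k → Matrix (Fin 2) (Fin 2) ℂ) (hQ0 : ∀ Y, Q 0 Y = Y)
    (hQs : ∀ (k : ℕ) (Y : PBond (F.P K) 0 → Matrix (Fin 2) (Fin 2) ℂ) (c : PBond (F.P K) (k + 1)), Q (k + 1) Y c
      = fderiv ℂ (eml : (Idx (F.P K) → Matrix (Fin 2) (Fin 2) ℂ) → Matrix (Fin 2) (Fin 2) ℂ)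
            (fun i => ((loopHol (Averaging.iter (fun i => blockAvg (P := F.P K) (j := i) (expMeanLogSU (n := Fin 2))) k W) c i :
              Matrix.specialUnitaryGroup (Fin 2) ℂ) : Matrix (Fin 2) (Fin 2) ℂ))
            (fun i => covWalkSum (Averaging.iter (fun i => blockAvg (P := F.P K) (j := i) (expMeanLogSU (n := Fin 2))) k W) (Q k Y)
                (walk (emb c.src) (loopWord (F.P K).L c.dir (off i.1) i.2.1 i.2.2))
              * ((loopHol (Averaging.iter (fun i => blockAvg (P := F.P K) (j := i) (expMeanLogSU (n := Fin 2))) k W) c i :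
                Matrix.specialUnitaryGroup (Fin 2) ℂ) : Matrix (Fin 2) (Fin 2) ℂ))
            * star ((corr (expMeanLogSU (n := Fin 2)) (Averaging.iter (fun i => blockAvg (P := F.P K) (j := i) (expMeanLogSU (n := Fin 2))) k W) c :
                Matrix.specialUnitaryGroup (Fin 2) ℂ) : Matrix (Fin 2) (Fin 2) ℂ)
          + ((corr (expMeanLogSU (n := Fin 2)) (Averaging.iter (fun i => blockAvg (P := F.P K) (j := i) (expMeanLogSU (n := Fin 2))) k W) c :
                Matrix.specialUnitaryGroup (Fin 2) ℂ) : Matrix (Fin 2) (Fin 2) ℂ)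
            * covWalkSum (Averaging.iter (fun i => blockAvg (P := F.P K) (j := i) (expMeanLogSU (n := Fin 2))) k W) (Q k Y)
                (walk (emb c.src) (List.replicate (F.P K).L (c.dir, true)))
            * star ((corr (expMeanLogSU (n := Fin 2)) (Averaging.iter (fun i => blockAvg (P := F.P K) (j := i) (expMeanLogSU (n := Fin 2))) k W) c :
                Matrix.specialUnitaryGroup (Fin 2) ℂ) : Matrix (Fin 2) (Fin 2) ℂ))
    -- ▢ hq — THE FIBRE-DEFECT ROW (pointwise second order along the averaging paths; routeR-w2): `8·Σ_c‖Q^{(K−n)}D(c)‖² ≤ θ_q·ℓ⁻¹·M + η_q·ℓ·DIV(D)`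
    (hq : 8 * ∑ c : PBond (F.P K) (K - n), ‖Q (K - n) D c‖ ^ 2 ≤ θ_q * ((F.L : ℝ) ^ (K - n))⁻¹ * (∑ b : PBond (F.P K) 0, ‖D b‖ ^ 2)
        + η_q * ((F.L : ℝ) ^ (K - n)) * (∑ x : Site (F.P K) 0, ∑ j : Fin 2, ∑ k : Fin 2,
              ‖(divB (torusT (F.P K) 0) (fun κ z => unitsField (toUField W) ⟨z, κ⟩) (fun κ z => Complex.I • D ⟨z, κ⟩) x) j k‖ ^ 2))
    -- ▢ hXb′ — THE GAUSS COMPOSITE against the COMB-DIRECT face functional FACE′ (corner comb `treeWord (update r μ_c (ℓ−1))`, far-face crossing `t₀ = ℓ − 1 − r_{μ_c}`, centre frame)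
    (hXb' : 2 * |∑ c : PBond (F.P K) (K - n), (((φ₀ (embIter (K - n) c.src)
          - ((Averaging.iter (fun i => blockAvg (P := F.P K) (j := i) (expMeanLogSU (n := Fin 2))) (K - n) W c : Matrix.specialUnitaryGroup (Fin 2) ℂ) : Matrix (Fin 2) (Fin 2) ℂ)
              * φ₀ (embIter (K - n) c.tgt)
              * star ((Averaging.iter (fun i => blockAvg (P := F.P K) (j := i) (expMeanLogSU (n := Fin 2))) (K - n) W c : Matrix.specialUnitaryGroup (Fin 2) ℂ) : Matrix (Fin 2) (Fin 2) ℂ))ᴴ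
          * ((((((F.P K).L : ℝ) ^ (K - n)) ^ (F.P K).d)⁻¹ •
              (((holAt W (walk (embIter (K - n) c.src) (treeWord fun _ : Fin (F.P K).d => -((((F.P K).L ^ (K - n) - 1) / 2 : ℕ) : ℤ))) : Matrix.specialUnitaryGroup (Fin 2) ℂ) :
                  Matrix (Fin 2) (Fin 2) ℂ)
                * ((((F.P K).L : ℝ) ^ (K - n)) • ∑ r : Fin (F.P K).d → Fin ((F.P K).L ^ (K - n)),
                    conjR (holT (unitsField (toUField W)) (Site.fibreSite 0 (K - n) c.src fun _ => ⟨0, pow_pos (F.P K).L_pos (K - n)⟩)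
                        (treeWord fun ν => ((Function.update r c.dir ⟨(F.P K).L ^ (K - n) - 1, Nat.sub_lt (pow_pos (F.P K).L_pos (K - n)) Nat.one_pos⟩ ν : ℕ) : ℤ)))
                      (B ⟨(fun z : Site (F.P K) 0 => z.shift c.dir)^[(F.P K).L ^ (K - n) - 1 - (r c.dir : ℕ)] (Site.fibreSite 0 (K - n) c.src r), c.dir⟩))
                * star (((holAt W (walk (embIter (K - n) c.src) (treeWord fun _ : Fin (F.P K).d => -((((F.P K).L ^ (K - n) - 1) / 2 : ℕ) : ℤ))) : Matrix.specialUnitaryGroup (Fin 2) ℂ) :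
                  Matrix (Fin 2) (Fin 2) ℂ)))))).trace).re|
      ≤ ((F.L : ℝ) ^ (K - n)) * (ζ_X / θ) * (∑ p : Plaq (F.P K) 0, ‖((Complex.I • D ⟨p.src, p.μ⟩) + ((W ⟨p.src, p.μ⟩ : Matrix (Fin 2) (Fin 2) ℂ) * (Complex.I • D ⟨p.src.shift p.μ, p.ν⟩) * star (W ⟨p.src, p.μ⟩ : Matrix (Fin 2) (Fin 2) ℂ))
            - (((W ⟨p.src, p.μ⟩ * W ⟨p.src.shift p.μ, p.ν⟩ * (W ⟨p.src.shift p.ν, p.μ⟩)⁻¹ : Matrix.specialUnitaryGroup (Fin 2) ℂ) : Matrix (Fin 2) (Fin 2) ℂ) * (Complex.I • D ⟨p.src.shift p.ν, p.μ⟩) * star ((W ⟨p.src, p.μ⟩ * W ⟨p.src.shift p.μ, p.ν⟩ * (W ⟨p.src.shift p.ν, p.μ⟩)⁻¹ : Matrix.specialUnitaryGroup (Fin 2) ℂ) : Matrix (Fin 2) (Fin 2) ℂ))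
            - (((GaugeField.plaqHol W p : Matrix.specialUnitaryGroup (Fin 2) ℂ) : Matrix (Fin 2) (Fin 2) ℂ) * (Complex.I • D ⟨p.src, p.ν⟩) * star ((GaugeField.plaqHol W p : Matrix.specialUnitaryGroup (Fin 2) ℂ) : Matrix (Fin 2) (Fin 2) ℂ)))‖ ^ 2)
        + θ * ((F.L : ℝ) ^ (K - n))⁻¹ * (∑ b : PBond (F.P K) 0, ‖D b‖ ^ 2)
        + θ_X * e * ((F.L : ℝ) ^ (K - n))⁻¹ * (∑ b : PBond (F.P K) 0, ‖D b‖ ^ 2)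
        + C_X * ((F.L : ℝ) ^ (K - n)) * (∑ b : PBond (F.P K) 0, ∑ ν : Fin (F.P K).d,
                ‖((W ⟨b.src, ν⟩ : Matrix.specialUnitaryGroup (Fin 2) ℂ) : Matrix (Fin 2) (Fin 2) ℂ) * B ⟨b.src.shift ν, b.dir⟩ * star ((W ⟨b.src, ν⟩ : Matrix.specialUnitaryGroup (Fin 2) ℂ) : Matrix (Fin 2) (Fin 2) ℂ) - B b‖ ^ 2)
        + η_X * ((F.L : ℝ) ^ (K - n)) * (∑ x : Site (F.P K) 0, ∑ j : Fin 2, ∑ k : Fin 2,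
              ‖(divB (torusT (F.P K) 0) (fun κ z => unitsField (toUField W) ⟨z, κ⟩) (fun κ z => Complex.I • D ⟨z, κ⟩) x) j k‖ ^ 2)) :
    (∑ c : PBond (F.P K) (K - n), ∑ a : Fin 2, ∑ b : Fin 2,
        Complex.normSq ((φ₀ (embIter (K - n) c.src) - ((Averaging.iter (fun i => blockAvg (P := F.P K) (j := i) (expMeanLogSU (n := Fin 2))) (K - n) W c : Matrix.specialUnitaryGroup (Fin 2) ℂ) : Matrix (Fin 2) (Fin 2) ℂ)
            * φ₀ (embIter (K - n) c.tgt) * star ((Averaging.iter (fun i => blockAvg (P := F.P K) (j := i) (expMeanLogSU (n := Fin 2))) (K - n) W c : Matrix.specialUnitaryGroup (Fin 2) ℂ) : Matrix (Fin 2) (Fin 2) ℂ)) a b))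
      ≤ ((F.L : ℝ) ^ (K - n)) * (ζ_X / θ) * (∑ p : Plaq (F.P K) 0, ‖((Complex.I • D ⟨p.src, p.μ⟩) + ((W ⟨p.src, p.μ⟩ : Matrix (Fin 2) (Fin 2) ℂ) * (Complex.I • D ⟨p.src.shift p.μ, p.ν⟩) * star (W ⟨p.src, p.μ⟩ : Matrix (Fin 2) (Fin 2) ℂ))
            - (((W ⟨p.src, p.μ⟩ * W ⟨p.src.shift p.μ, p.ν⟩ * (W ⟨p.src.shift p.ν, p.μ⟩)⁻¹ : Matrix.specialUnitaryGroup (Fin 2) ℂ) : Matrix (Fin 2) (Fin 2) ℂ) * (Complex.I • D ⟨p.src.shift p.ν, p.μ⟩) * star ((W ⟨p.src, p.μ⟩ * W ⟨p.src.shift p.μ, p.ν⟩ * (W ⟨p.src.shift p.ν, p.μ⟩)⁻¹ : Matrix.specialUnitaryGroup (Fin 2) ℂ) : Matrix (Fin 2) (Fin 2) ℂ))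
            - (((GaugeField.plaqHol W p : Matrix.specialUnitaryGroup (Fin 2) ℂ) : Matrix (Fin 2) (Fin 2) ℂ) * (Complex.I • D ⟨p.src, p.ν⟩) * star ((GaugeField.plaqHol W p : Matrix.specialUnitaryGroup (Fin 2) ℂ) : Matrix (Fin 2) (Fin 2) ℂ)))‖ ^ 2)
        + (θ + θ_q) * ((F.L : ℝ) ^ (K - n))⁻¹ * (∑ b : PBond (F.P K) 0, ‖D b‖ ^ 2)
        + (θ_X + 64 * ((4770 * (F.L : ℝ) ^ 3) ^ 2 * ((5 * (F.L : ℝ)) ^ 2 / 2) ^ 2 / 4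
              + (2 * (5 * (F.L : ℝ)) ^ 3 / ((F.L : ℝ) * ((F.L : ℝ) - 1) * ((F.L : ℝ) ^ 2 - 1)) + (2 * (5 * (F.L : ℝ)) + 2 * 3 + 1) ^ 2 / 2) ^ 2)
              + 768000000000 * (F.L : ℝ) ^ 9 + 16) * e * ((F.L : ℝ) ^ (K - n))⁻¹ * (∑ b : PBond (F.P K) 0, ‖D b‖ ^ 2)
        + (C_X + 24) * ((F.L : ℝ) ^ (K - n)) * (∑ b : PBond (F.P K) 0, ∑ ν : Fin (F.P K).d,
                ‖((W ⟨b.src, ν⟩ : Matrix.specialUnitaryGroup (Fin 2) ℂ) : Matrix (Fin 2) (Fin 2) ℂ) * B ⟨b.src.shift ν, b.dir⟩ * star ((W ⟨b.src, ν⟩ : Matrix.specialUnitaryGroup (Fin 2) ℂ) : Matrix (Fin 2) (Fin 2) ℂ) - B b‖ ^ 2)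
        + 19200 * (F.L : ℝ) ^ 4 * ((F.L : ℝ) ^ (K - n)) * (∑ x : Site (F.P K) 0, ∑ μ : Fin (F.P K).d, ∑ ν : Fin (F.P K).d,
                (if μ < ν then ∑ j : Fin 2, ∑ k : Fin 2, ‖(curl (torusT (F.P K) 0) (fun κ z => unitsField (toUField W) ⟨z, κ⟩) (fun κ z => B ⟨z, κ⟩) μ ν x) j k‖ ^ 2 else 0))
        + (η_X + η_q) * ((F.L : ℝ) ^ (K - n)) * (∑ x : Site (F.P K) 0, ∑ j : Fin 2, ∑ k : Fin 2,
              ‖(divB (torusT (F.P K) 0) (fun κ z => unitsField (toUField W) ⟨z, κ⟩) (fun κ z => Complex.I • D ⟨z, κ⟩) x) j k‖ ^ 2) := by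
  -- ===== member letters =====
  have hd : (F.P K).d = 3 := T3Family.P_d F K
  have hLF : (F.P K).L = F.L := rfl
  have hL3 := three_le_L F
  have hLpos : (0 : ℝ) < (F.L : ℝ) := by linarith
  have hℓ : (0 : ℝ) < (F.L : ℝ) ^ (K - n) := pow_pos hLpos _
  have hk : K - n ≤ (F.P K).m + (F.P K).K := by show K - n ≤ F.m + K; omega
  have h9604 : 9604 * e ≤ 1 := by
    have h5 : (3 : ℝ) ^ 5 ≤ (F.L : ℝ) ^ 5 := pow_le_pow_left₀ (by norm_num) hL3 5
    nlinarith
  -- ===== the comb-direct (E)-row at the member letters (px15 ✓`sum_normSq_lineFun_sub_combFaceFun_le`, δ := 2e·ℓ⁻²) =====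
  have hU' : PlaqSmall (2 * e * ((((F.P K).L : ℝ) ^ (K - n))⁻¹) ^ 2) W := by
    refine plaqSmall_of_le_of_lt hW ?_
    rw [hLF, inv_pow]
    exact mul_lt_mul_of_pos_right (by linarith only [he]) (inv_pos.mpr (by positivity))
  have hδ0 : (0 : ℝ) ≤ 2 * e * ((((F.P K).L : ℝ) ^ (K - n))⁻¹) ^ 2 := by
    have := he.le
    positivity
  have h0k : (F.P K).sitesPerDir 0 = (F.P K).L ^ (K - n) * (F.P K).sitesPerDir (K - n) := Prop7FlatCoercivity.sitesPerDir_zero_eq_pow_mul hk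
  have hgL : ∀ c : PBond (F.P K) (K - n), ‖(((holAt W (walk (embIter (K - n) c.src) (treeWord fun _ : Fin (F.P K).d => -((((F.P K).L ^ (K - n) - 1) / 2 : ℕ) : ℤ))) : Matrix.specialUnitaryGroup (Fin 2) ℂ) : Matrix (Fin 2) (Fin 2) ℂ))‖ ≤ 1 := fun c =>
    le_of_eq (CStarRing.norm_of_mem_unitary (Matrix.specialUnitaryGroup_le_unitaryGroup (holAt W (walk (embIter (K - n) c.src)
      (treeWord fun _ : Fin (F.P K).d => -((((F.P K).L ^ (K - n) - 1) / 2 : ℕ) : ℤ)))).2))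
  have hgR : ∀ c : PBond (F.P K) (K - n), ‖star (((holAt W (walk (embIter (K - n) c.src) (treeWord fun _ : Fin (F.P K).d => -((((F.P K).L ^ (K - n) - 1) / 2 : ℕ) : ℤ))) : Matrix.specialUnitaryGroup (Fin 2) ℂ) : Matrix (Fin 2) (Fin 2) ℂ))‖ ≤ 1 := fun c => by
    rw [norm_star]; exact hgL c
  have hs' : ∀ (c : PBond (F.P K) (K - n)) (r : Fin (F.P K).d → Fin ((F.P K).L ^ (K - n))),
      (((F.P K).L ^ (K - n) - 1 : ℕ)) = (r c.dir : ℕ) + ((F.P K).L ^ (K - n) - 1 - (r c.dir : ℕ)) := by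
    intro c r
    have := (r c.dir).isLt
    omega
  have h0 := sum_normSq_lineFun_sub_combFaceFun_le h0k W hδ0 hU' (fun c => (((holAt W (walk (embIter (K - n) c.src) (treeWord fun _ : Fin (F.P K).d => -((((F.P K).L ^ (K - n) - 1) / 2 : ℕ) : ℤ))) : Matrix.specialUnitaryGroup (Fin 2) ℂ) : Matrix (Fin 2) (Fin 2) ℂ))) (fun c => star (((holAt W (walk (embIter (K - n) c.src) (treeWord fun _ : Fin (F.P K).d => -((((F.P K).L ^ (K - n) - 1) / 2 : ℕ) : ℤ))) : Matrix.specialUnitaryGroup (Fin 2) ℂ) : Matrix (Fin 2) (Fin 2) ℂ))) hgL hgR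
    (fun (c : PBond (F.P K) (K - n)) (r : Fin (F.P K).d → Fin ((F.P K).L ^ (K - n))) => (F.P K).L ^ (K - n) - 1 - (r c.dir : ℕ))
    (fun (_ : PBond (F.P K) (K - n)) (_ : Fin (F.P K).d → Fin ((F.P K).L ^ (K - n))) =>
      (⟨(F.P K).L ^ (K - n) - 1, Nat.sub_lt (pow_pos (F.P K).L_pos (K - n)) Nat.one_pos⟩ : Fin ((F.P K).L ^ (K - n)))) hs' B
  -- ===== §2 with the rows pending =====
  have hA := rowP_of_faceFluxRows_of_hE F n K W (θ := θ) (ζ_X := ζ_X) (θ_X := θ_X) (C_X := C_X) (η_X := η_X) he heL hW D B φ₀ hsplit hBc Q hQ0 hQs hq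
    (fun c => ((((((F.P K).L : ℝ) ^ (K - n)) ^ (F.P K).d)⁻¹ •
              (((holAt W (walk (embIter (K - n) c.src) (treeWord fun _ : Fin (F.P K).d => -((((F.P K).L ^ (K - n) - 1) / 2 : ℕ) : ℤ))) : Matrix.specialUnitaryGroup (Fin 2) ℂ) :
                  Matrix (Fin 2) (Fin 2) ℂ)
                * ((((F.P K).L : ℝ) ^ (K - n)) • ∑ r : Fin (F.P K).d → Fin ((F.P K).L ^ (K - n)),
                    conjR (holT (unitsField (toUField W)) (Site.fibreSite 0 (K - n) c.src fun _ => ⟨0, pow_pos (F.P K).L_pos (K - n)⟩)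
                        (treeWord fun ν => ((Function.update r c.dir ⟨(F.P K).L ^ (K - n) - 1, Nat.sub_lt (pow_pos (F.P K).L_pos (K - n)) Nat.one_pos⟩ ν : ℕ) : ℤ)))
                      (B ⟨(fun z : Site (F.P K) 0 => z.shift c.dir)^[(F.P K).L ^ (K - n) - 1 - (r c.dir : ℕ)] (Site.fibreSite 0 (K - n) c.src r), c.dir⟩))
                * star (((holAt W (walk (embIter (K - n) c.src) (treeWord fun _ : Fin (F.P K).d => -((((F.P K).L ^ (K - n) - 1) / 2 : ℕ) : ℤ))) : Matrix.specialUnitaryGroup (Fin 2) ℂ) :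
                  Matrix (Fin 2) (Fin 2) ℂ)))))) (C_E := 3) (θ_E := 2)
  -- ===== names for the energies =====
  set MD : ℝ := (∑ b : PBond (F.P K) 0, ‖D b‖ ^ 2) with hMD
  set MB : ℝ := (∑ b : PBond (F.P K) 0, ‖B b‖ ^ 2) with hMB
  set GW : ℝ := (∑ b : PBond (F.P K) 0, ∑ ν : Fin (F.P K).d,
                ‖((W ⟨b.src, ν⟩ : Matrix.specialUnitaryGroup (Fin 2) ℂ) : Matrix (Fin 2) (Fin 2) ℂ) * B ⟨b.src.shift ν, b.dir⟩ * star ((W ⟨b.src, ν⟩ : Matrix.specialUnitaryGroup (Fin 2) ℂ) : Matrix (Fin 2) (Fin 2) ℂ) - B b‖ ^ 2) with hGW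
  set GLo : ℝ := (∑ b : PBond (F.P K) 0, ‖conjR (unitsField (toUField W) b) (B ⟨b.src.shift b.dir, b.dir⟩) - B b‖ ^ 2) with hGLo
  have hMD0 : 0 ≤ MD := Finset.sum_nonneg fun _ _ => sq_nonneg _
  have hMB0 : 0 ≤ MB := Finset.sum_nonneg fun _ _ => sq_nonneg _
  have hGLo0 : 0 ≤ GLo := Finset.sum_nonneg fun _ _ => sq_nonneg _
  have hGLW : GLo ≤ GW := sum_longGrad_le_covGrad W B
  have hBM : MB ≤ 2 * MD := by
    have h := sum_norm_sq_le_of_coclosed_split (N := 2) W D B φ₀ hsplit hBc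
    simpa only [Nat.cast_ofNat] using h
  -- ===== the (E)-row in (P) currencies: `C_E = 3`, `θ_E = 2` =====
  have key : 2 * ((((F.P K).L : ℝ) ^ (K - n)) ^ 4 * ((((F.P K).L : ℝ) ^ (K - n)) ^ (F.P K).d)⁻¹ * GLo)
        + 2 * ((((((2 * (F.P K).d + 1) * (F.P K).L ^ (K - n) : ℕ) : ℝ) ^ 2 / 2) * (2 * e * ((((F.P K).L : ℝ) ^ (K - n))⁻¹) ^ 2)) ^ 2 * 2
            * (((F.P K).L : ℝ) ^ (K - n)) ^ 2 * ((((F.P K).L : ℝ) ^ (K - n)) ^ (F.P K).d)⁻¹ * (MB + (((F.P K).L : ℝ) ^ (K - n)) ^ 2 * GLo))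
      ≤ 3 * ((F.L : ℝ) ^ (K - n)) * GW + 2 * e * ((F.L : ℝ) ^ (K - n))⁻¹ * MD := by
    have hb := face_prime_booking (ℓ := (F.L : ℝ) ^ (K - n)) hℓ he.le h9604 hGLo0 hMB0 hGLW hBM
    rw [hd]
    push_cast
    simp only [hLF]
    linarith [hb]
  have hfin := hA (h0.trans key) hXb'
  -- bookkeeping: `8·2 = 16`, `8·3 = 24`
  linarith only [hfin]

end Summit.QuantumFields.YangMills.Theorems.Prop7RowPOfCombFaceFluxRows

end
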